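import Literature.Analysis.FluidPDE.ClassicalDriftNSLocalEnergy
import HarnessLib

/-!
# Classical drift solutions on `[0, T]` for every `T` are classical drift solutions on `(0, ∞)`

Analysis/FluidPDE glue serving the discharge of
`Literature.Analysis.FluidPDE.leray_regularised_wellposed`: constructions of the regularised
solution proceed slab by slab (`RegSetup` on `[0, T]`, `NSRegFourierSolution`; continuation
`NSRegFourierGlobal`), whereas the separation of energy (`LerayTailHyp.solution`,
`LeraySeparationOfEnergy`) and the `C¹((0,∞) × E)` field of `leray_regularised_wellposed` are
stated on the open half-line. Since joint smoothness is local and the one-sided time derivatives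
`timeDerivWithin (Icc 0 T)` and `timeDerivWithin (Ioi 0)` both agree with the two-sided one at
interior times, a field that is a classical drift solution on `[0, T]` for every `T > 0` is one on
`(0, ∞)` (`isClassicalDriftNSSolutionOn_Ioi_of_Icc`), and in particular jointly `C¹` there.

## References

* J. Leray, Acta Math. 63 (1934), Ch. V §26. [Leray1934]
-/

noncomputable section

open Set Filter Function
open scoped Topology ContDiff

namespace Literature.Analysis.FluidPDE

variable {E : Type*} [NormedAddCommGroup E] [InnerProductSpace ℝ E] [FiniteDimensional ℝ E]

/-- Joint smoothness on every closed slab `[0, T] × X` gives joint smoothness on `(0, ∞) × X`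
(smoothness is a local property, and `[0, T] × X` is a neighbourhood of every `(t, x)` with
`0 < t < T`). [folklore] -/
theorem isSmoothSpaceTimeOn_Ioi_of_Icc {X F : Type*} [NormedAddCommGroup X] [NormedSpace ℝ X]
    [NormedAddCommGroup F] [NormedSpace ℝ F] {v : ℝ → X → F}
    (h : ∀ T, 0 < T → IsSmoothSpaceTimeOn (Icc 0 T) v) : IsSmoothSpaceTimeOn (Ioi 0) v := by
  intro z hz
  obtain ⟨t, x⟩ := z
  have ht : 0 < t := hz.1
  have hmem : (t, x) ∈ Icc 0 (t + 1) ×ˢ (univ : Set X) := ⟨⟨ht.le, by linarith⟩, mem_univ _⟩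
  have hlt : t < t + 1 := by linarith
  have hnhds : Icc 0 (t + 1) ×ˢ (univ : Set X) ∈ 𝓝 (t, x) := by
    refine mem_of_superset (prod_mem_nhds (Ioo_mem_nhds ht hlt) univ_mem) ?_
    exact prod_mono Ioo_subset_Icc_self Subset.rfl
  exact ((h (t + 1) (by linarith)) (t, x) hmem).mono_of_mem_nhdsWithin
    (mem_nhdsWithin_of_mem_nhds hnhds)

variable {ν : ℝ} {w u : ℝ → E → E} {p : ℝ → E → ℝ}

/-- **From slabs to the half-line**: if `(w, u, p)` is a classical solution of the drift system
`∂ₜu + (w·∇)u = νΔu − ∇p`, `div u = div w = 0` on `[0, T]` for every `T > 0`, then it is one on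
`(0, ∞)` (at an interior time both one-sided time derivatives are the two-sided one). [folklore] -/
theorem isClassicalDriftNSSolutionOn_Ioi_of_Icc
    (h : ∀ T, 0 < T → IsClassicalDriftNSSolutionOn (Icc 0 T) ν w u p) :
    IsClassicalDriftNSSolutionOn (Ioi 0) ν w u p where
  smooth_velocity := isSmoothSpaceTimeOn_Ioi_of_Icc fun T hT => (h T hT).smooth_velocity
  smooth_drift := isSmoothSpaceTimeOn_Ioi_of_Icc fun T hT => (h T hT).smooth_drift
  smooth_pressure := isSmoothSpaceTimeOn_Ioi_of_Icc fun T hT => (h T hT).smooth_pressure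
  momentum t ht x := by
    have ht0 : 0 < t := ht
    have hT : 0 < t + 1 := by linarith
    have h1 : timeDerivWithin (Ioi 0) u t x = timeDeriv u t x :=
      timeDerivWithin_of_mem_interior (by rwa [interior_Ioi]) x
    have h2 : timeDerivWithin (Icc 0 (t + 1)) u t x = timeDeriv u t x :=
      timeDerivWithin_of_mem_interior (by rw [interior_Icc]; exact ⟨ht0, by linarith⟩) x
    rw [h1, ← h2]
    exact (h (t + 1) hT).momentum t ⟨ht0.le, by linarith⟩ x
  divFree t ht := by
    have ht0 : 0 < t := ht
    exact (h (t + 1) (by linarith)).divFree t ⟨ht0.le, by linarith⟩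
  divFree_drift t ht := by
    have ht0 : 0 < t := ht
    exact (h (t + 1) (by linarith)).divFree_drift t ⟨ht0.le, by linarith⟩

/-- In particular such a field is jointly `C¹` on `(0, ∞) × E` — the `contDiffOn` field of
`leray_regularised_wellposed` / `IsLerayRegularisedScheme`. [folklore] -/
theorem contDiffOn_one_Ioi_of_Icc {X F : Type*} [NormedAddCommGroup X] [NormedSpace ℝ X]
    [NormedAddCommGroup F] [NormedSpace ℝ F] {v : ℝ → X → F}
    (h : ∀ T, 0 < T → IsSmoothSpaceTimeOn (Icc 0 T) v) :
    ContDiffOn ℝ 1 (uncurry v) (Ioi 0 ×ˢ univ) :=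
  (isSmoothSpaceTimeOn_Ioi_of_Icc h).of_le (by norm_cast)

end Literature.Analysis.FluidPDE

end
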